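import Summits.AtomisticToContinuum.Crystallization.Theorems.ChartedZeroExcessLayeredLatticeLiouvilleZZZVA

/-!
# ChartedZeroExcess · LayeredLatticeLiouville ZZZVB (lens-2 g89 NODE 89 «LabelChain», part 2 of 3: ZZZV-3 geometry of the exit direction, ZZZV-4 the
# label chain — one greedy segment, seven blocks of three segments)

See part 1 (`…ZZZVA`) for the node's module docstring.  0 sorry; imports = part 1 only; axioms standard.
-/

noncomputable section
open scoped BigOperators Classical InnerProductSpace RealInnerProductSpace
open MeasureTheory Set Metric Filter Topology
open Literature.Geometry.DiscreteGeometry (IsTwoShellGoodSet fccTwoShellPattern hcpTwoShellPattern card_filter_norm_eq_one_of_twoShellPattern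
  norm_of_mem_twoShellPattern)
open Literature.MathematicalPhysics.StatisticalMechanics (lennardJones)

namespace Summit.AtomisticToContinuum.Crystallization.Theorems.ChartedZeroExcessLayeredLatticeLiouville

open Summit.AtomisticToContinuum.Crystallization.Theorems.ChartedPlanarOrderRigidityDoor (E3 IsClean)
open Summit.AtomisticToContinuum.Crystallization.Theorems.ChartedPlanarOrderDensityDichotomy (μS IsSep)
open Summit.AtomisticToContinuum.Crystallization.Theorems.ChartedPlanarOrderCleanScaleP (IsCleanP IsDoorSetP)
open Summit.AtomisticToContinuum.Crystallization.Theorems.ChartedPlanarOrderMesoCut (LayeredHom EnvClose)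
open Summit.AtomisticToContinuum.Crystallization.Theorems.ChartedPlanarOrderDoorLayeredOsc (IsTwoShellAffineGood mem_iff_μS_singleton_ne_zero)

/-! ### ZZZV-3  Elementary geometry of the exit direction -/

section Geometry

/-- the FAR CORE SITE in direction `u` is within `√(rΘ² + q²)` of the start: `‖p₀ − kᵤ‖² ≤ rΘ² + q²`. [this file, g89] -/
theorem labelChain_start_sq {p₀ x₀ k₁ kᵤ u : E3} {D rΘ q : ℝ} (hu : ‖u‖ = 1) (hD : p₀ - x₀ = D • u) (hD0 : 0 ≤ D)
    (hk₁ : dist p₀ k₁ ≤ rΘ) (hmax : ⟪k₁, u⟫ ≤ ⟪kᵤ, u⟫) (hq : dist kᵤ x₀ ≤ q) : dist p₀ kᵤ ^ 2 ≤ rΘ ^ 2 + q ^ 2 := by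
  have e1 : ∀ k : E3, p₀ - k = D • u - (k - x₀) := fun k => by rw [← hD]; abel
  have hexp : ∀ k : E3, dist p₀ k ^ 2 = D ^ 2 - 2 * D * ⟪k - x₀, u⟫ + dist k x₀ ^ 2 := by
    intro k
    rw [dist_eq_norm, e1 k, norm_sub_sq_real, norm_smul, hu, mul_one, Real.norm_eq_abs, abs_of_nonneg hD0, real_inner_smul_left,
      real_inner_comm (k - x₀) u, dist_eq_norm]
    ring
  have h1 := hexp k₁
  have h2 := hexp kᵤ
  have hrΘ : 0 ≤ rΘ := dist_nonneg.trans hk₁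
  have hq0 : 0 ≤ q := dist_nonneg.trans hq
  have hk₁sq : dist p₀ k₁ ^ 2 ≤ rΘ ^ 2 := by nlinarith [dist_nonneg (x := p₀) (y := k₁)]
  have hqsq : dist kᵤ x₀ ^ 2 ≤ q ^ 2 := by nlinarith [dist_nonneg (x := kᵤ) (y := x₀)]
  have hmax' : ⟪k₁ - x₀, u⟫ ≤ ⟪kᵤ - x₀, u⟫ := by rw [inner_sub_left, inner_sub_left]; linarith
  nlinarith [dist_nonneg (x := k₁) (y := x₀), sq_nonneg (dist k₁ x₀), mul_le_mul_of_nonneg_left hmax' (by linarith : (0:ℝ) ≤ 2 * D)]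

/-- the EXIT VECTOR is short: `‖kᵤ + λ•u − p₀‖ ≤ q + λ` (`0 ≤ D ≤ 2λ`). [this file, g89] -/
theorem labelChain_exit_norm {p₀ x₀ kᵤ u : E3} {D lam q : ℝ} (hu : ‖u‖ = 1) (hD : p₀ - x₀ = D • u) (hD0 : 0 ≤ D) (hD2 : D ≤ 2 * lam)
    (hq : dist kᵤ x₀ ≤ q) : ‖kᵤ + lam • u - p₀‖ ≤ q + lam := by
  have e1 : kᵤ + lam • u - p₀ = (kᵤ - x₀) + (lam - D) • u := by rw [sub_smul, ← hD]; abel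
  rw [e1]
  calc ‖kᵤ - x₀ + (lam - D) • u‖ ≤ ‖kᵤ - x₀‖ + ‖(lam - D) • u‖ := norm_add_le _ _
    _ = dist kᵤ x₀ + |lam - D| := by rw [dist_eq_norm, norm_smul, hu, mul_one, Real.norm_eq_abs]
    _ ≤ q + lam := add_le_add hq (abs_le.2 ⟨by linarith, by linarith⟩)

/-- a point of the SEGMENT from `p₀` to `z` stays within `R₀` of `kᵤ` if both ends do. [this file, g89] -/
theorem labelChain_segment_ball {p₀ z kᵤ : E3} {R₀ θ : ℝ} (h0 : dist p₀ kᵤ ≤ R₀) (h1 : dist z kᵤ ≤ R₀) (hθ0 : 0 ≤ θ) (hθ1 : θ ≤ 1) :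
    dist (p₀ + θ • (z - p₀)) kᵤ ≤ R₀ := by
  have e1 : p₀ + θ • (z - p₀) - kᵤ = (1 - θ) • (p₀ - kᵤ) + θ • (z - kᵤ) := by
    simp only [sub_smul, one_smul, smul_sub]; abel
  rw [dist_eq_norm, e1]
  calc ‖(1 - θ) • (p₀ - kᵤ) + θ • (z - kᵤ)‖ ≤ ‖(1 - θ) • (p₀ - kᵤ)‖ + ‖θ • (z - kᵤ)‖ := norm_add_le _ _
    _ = (1 - θ) * dist p₀ kᵤ + θ * dist z kᵤ := by
        rw [norm_smul, norm_smul, Real.norm_eq_abs, Real.norm_eq_abs, abs_of_nonneg (by linarith), abs_of_nonneg hθ0, dist_eq_norm, dist_eq_norm]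
    _ ≤ (1 - θ) * R₀ + θ * R₀ := add_le_add (mul_le_mul_of_nonneg_left h0 (by linarith)) (mul_le_mul_of_nonneg_left h1 hθ0)
    _ = R₀ := by ring

/-- ★ THE CAP IS COOL: a point within `η` of the exit point `z = kᵤ + λ•u` is at distance `≥ λ − η` from every core site (`kᵤ` maximises `⟪·, u⟫`
over `K`). [this file, g89] -/
theorem labelChain_cap_far {p z kᵤ k u : E3} {lam η : ℝ} (hu : ‖u‖ = 1) (hmax : ⟪k, u⟫ ≤ ⟪kᵤ, u⟫) (hz : z = kᵤ + lam • u) (hpz : dist p z ≤ η) :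
    lam - η ≤ dist p k := by
  have h1 : ⟪p - k, u⟫ ≤ dist p k := by
    have := real_inner_le_norm (p - k) u
    rw [hu, mul_one, ← dist_eq_norm] at this
    exact this
  have h2 : ⟪p - z, u⟫ ≥ -η := by
    have := abs_real_inner_le_norm (p - z) u
    rw [hu, mul_one, ← dist_eq_norm] at this
    have := (abs_le.1 (this.trans hpz)).1
    linarith
  have h3 : ⟪z - kᵤ, u⟫ = lam := by
    rw [hz, add_sub_cancel_left, real_inner_smul_left, real_inner_self_eq_norm_sq, hu]; ring
  have e : p - k = (p - z) + (z - kᵤ) + (kᵤ - k) := by abel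
  have h4 : ⟪p - k, u⟫ = ⟪p - z, u⟫ + ⟪z - kᵤ, u⟫ + ⟪kᵤ - k, u⟫ := by rw [e, inner_add_left, inner_add_left]
  have h5 : ⟪kᵤ - k, u⟫ ≥ 0 := by rw [inner_sub_left]; linarith
  linarith

end Geometry

/-! ### ZZZV-4  The label chain: one greedy segment, and seven blocks of three segments -/

section Chain

variable {S C core : Set E3} {lab : E3 → E3} {kᵤ e₀ : E3} {ϑr Rg sb R₀ R₁ : ℝ}

/-- ★★ **ONE GREEDY SEGMENT OF THE LABEL CHAIN (PROVED)** — strong induction on the integer part of `100·dist²` to the way-point.  Context: a descent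
step supply in `C` (`hstep`, from `shadow_descent_step`), labels of established atoms lie in `C` (`hlabC`), local label surjectivity (`hlift`, from
`exists_contact_of_bonded_label`), atoms within `R₁ + 17/16` of `kᵤ` are core sites (`hcoreR`), and the NO-HOP hypothesis (★) `hstar`: two core sites
whose labels are within `Rg` have deviations `e = p − lab p` within `sb`.  From an established atom `p` (label within `31/20` of the way-point `tgt`,
deviation within `(d+1)·sb` of `e₀`, the way-point's ANCHOR atom `anc` having depth `d` and label within `61/20` of `tgt`) the greedy descent reaches an
established atom whose label is within the capture radius `4/5` of `tgt`, every new atom being compared with the anchor (label distance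
`≤ 31/20 + 61/20 = 23/5 ≤ Rg`), so that its depth stays `d + 1`. [this file, g89] -/
theorem labelChain_segment {tgt anc : E3} {d : ℕ}
    (hstep : ∀ c ∈ C, ∀ g : E3, ∃ a : ℝ, 9 / 10 ≤ a ∧ a ≤ 1 ∧ ∃ c' ∈ C, ∃ y : E3,
      dist c' y ≤ a / 16 + ϑr ∧ dist y c = a ∧ dist y (c + g) ^ 2 ≤ ‖g‖ ^ 2 - Real.sqrt 2 * a * ‖g‖ + a ^ 2)
    (hϑr : ϑr ≤ 1 / 10000) (hlabC : ∀ p ∈ S, dist p kᵤ ≤ R₁ → lab p ∈ C)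
    (hlift : ∀ p ∈ S, dist p kᵤ ≤ R₁ → ∀ c' ∈ C, IsBond (lab p) c' → ∃ p' ∈ S, dist p p' ≤ 17 / 16 ∧ lab p' = c')
    (hcoreR : ∀ p ∈ S, dist p kᵤ ≤ R₁ + 17 / 16 → p ∈ core)
    (hstar : ∀ p ∈ core, ∀ p' ∈ core, dist (lab p) (lab p') ≤ Rg → ‖(p - lab p) - (p' - lab p')‖ ≤ sb)
    (hanc : anc ∈ core) (hancd : ‖(anc - lab anc) - e₀‖ ≤ d * sb) (htgt : dist tgt (lab anc) ≤ 61 / 20)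
    (hRg : 23 / 5 ≤ Rg) (hsb : 0 ≤ sb) (hd : (d : ℝ) + 1 ≤ 7) (hsb7 : 7 * sb ≤ 7 / 20)
    (hball : dist (tgt + e₀) kᵤ ≤ R₀) (hR₁ : R₀ + 19 / 10 ≤ R₁) :
    ∀ (m : ℕ) (p : E3), p ∈ S → dist p kᵤ ≤ R₁ → dist (lab p) tgt ≤ 31 / 20 → ‖(p - lab p) - e₀‖ ≤ (d + 1) * sb →
      ⌊100 * dist (lab p) tgt ^ 2⌋₊ ≤ m →
        ∃ p₁ ∈ S, dist p₁ kᵤ ≤ R₁ ∧ dist (lab p₁) tgt ≤ 4 / 5 ∧ ‖(p₁ - lab p₁) - e₀‖ ≤ (d + 1) * sb := by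
  intro m
  induction m with
  | zero =>
    intro p hp hpk hpt hpe hm
    refine ⟨p, hp, hpk, ?_, hpe⟩
    have h1 : 100 * dist (lab p) tgt ^ 2 < 1 := Nat.floor_eq_zero.1 (Nat.le_zero.1 hm)
    nlinarith [dist_nonneg (x := lab p) (y := tgt)]
  | succ m ih =>
    intro p hp hpk hpt hpe hm
    by_cases hclose : dist (lab p) tgt ≤ 4 / 5
    · exact ⟨p, hp, hpk, hclose, hpe⟩
    push Not at hclose
    -- one descent step from `c = lab p` towards `tgt`
    obtain ⟨a, ha1, ha2, c', hc'C, y, hc'y, hyc, hprog⟩ := hstep (lab p) (hlabC p hp hpk) (tgt - lab p)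
    have hcg : lab p + (tgt - lab p) = tgt := by abel
    rw [hcg, ← dist_eq_norm, dist_comm tgt (lab p)] at hprog
    set D : ℝ := dist (lab p) tgt with hDdef
    have hD0 : 0 ≤ D := dist_nonneg
    have hgain := descent_gain ha1 ha2 hclose.le (dist_nonneg : 0 ≤ dist c' y) (by linarith) (dist_nonneg : 0 ≤ dist y tgt) hprog
    have hnew_le : dist c' tgt ≤ dist c' y + dist y tgt := dist_triangle _ _ _
    have hnew_sq : dist c' tgt ^ 2 ≤ D ^ 2 - 1 / 100 := by
      have h := mul_self_le_mul_self dist_nonneg hnew_le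
      rw [← pow_two, ← pow_two] at h
      exact h.trans hgain
    have hnewD : dist c' tgt ≤ D := by
      have h : dist c' tgt ^ 2 ≤ D ^ 2 := by linarith
      have h' := Real.sqrt_le_sqrt h
      rwa [Real.sqrt_sq dist_nonneg, Real.sqrt_sq hD0] at h'
    -- the new site is bonded to `lab p`
    have hbond : IsBond (lab p) c' := by
      have hlo : a - (a / 16 + ϑr) ≤ dist (lab p) c' := by
        have := dist_triangle y c' (lab p)
        rw [dist_comm y c'] at this
        rw [dist_comm]; linarith
      have hhi : dist (lab p) c' ≤ a / 16 + ϑr + a := by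
        have := dist_triangle c' y (lab p)
        rw [dist_comm]; linarith
      exact ⟨by linarith, by linarith⟩
    -- lift it to an atom
    obtain ⟨p', hp'S, hpp', hlabp'⟩ := hlift p hp hpk c' hc'C hbond
    have hp'core : p' ∈ core := hcoreR p' hp'S (by linarith [dist_triangle p' p kᵤ, dist_comm p p'])
    -- compare with the anchor: label distance `≤ D + 61/20 ≤ Rg`
    have hlabdist : dist (lab p') (lab anc) ≤ Rg := by
      rw [hlabp']
      linarith [dist_triangle c' tgt (lab anc)]
    have hdev : ‖(p' - lab p') - e₀‖ ≤ (d + 1) * sb := by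
      have h1 := hstar p' hp'core anc hanc hlabdist
      have e : (p' - lab p') - e₀ = ((p' - lab p') - (anc - lab anc)) + ((anc - lab anc) - e₀) := by abel
      rw [e]
      linarith [norm_add_le ((p' - lab p') - (anc - lab anc)) ((anc - lab anc) - e₀)]
    -- position of the new atom: `p′ = lab p′ + e p′`
    have hp'k : dist p' kᵤ ≤ R₁ := by
      have e : p' - kᵤ = ((p' - lab p') - e₀) + (lab p' - tgt) + (tgt + e₀ - kᵤ) := by abel
      have h1 : ‖(p' - lab p') - e₀ + (lab p' - tgt) + (tgt + e₀ - kᵤ)‖ ≤ ‖(p' - lab p') - e₀‖ + ‖lab p' - tgt‖ + ‖tgt + e₀ - kᵤ‖ :=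
        norm_add₃_le
      have h2 : ‖lab p' - tgt‖ ≤ D := by rw [← dist_eq_norm, hlabp']; exact hnewD
      have h3 : ‖tgt + e₀ - kᵤ‖ ≤ R₀ := by rw [← dist_eq_norm]; exact hball
      have h7 : ((d : ℝ) + 1) * sb ≤ 7 * sb := mul_le_mul_of_nonneg_right hd hsb
      rw [dist_eq_norm, e]
      linarith
    -- the measure dropped
    have hm' : ⌊100 * dist (lab p') tgt ^ 2⌋₊ ≤ m := by
      rw [hlabp']
      have h1 : ⌊100 * dist c' tgt ^ 2⌋₊ ≤ ⌊100 * D ^ 2 - 1⌋₊ := Nat.floor_mono (by linarith)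
      have h2 : ⌊100 * D ^ 2 - 1⌋₊ + 1 = ⌊100 * D ^ 2⌋₊ := by
        rw [← Nat.floor_add_one (by nlinarith : (0 : ℝ) ≤ 100 * D ^ 2 - 1), sub_add_cancel]
      omega
    exact ih p' hp'S hp'k (by rw [hlabp']; linarith) hdev hm'

/-- ★★ **SEVEN BLOCKS OF THREE SEGMENTS (PROVED)**: along the way-points `tw j = lab p₀ + (j/21)•V` (`‖V‖ ≤ 63/4`, so consecutive way-points are
`≤ 3/4` apart, and `tw j + e₀` stays within `R₀` of `kᵤ` for `j ≤ 21`), the chain reaches after `b ≤ 7` blocks an established atom whose label is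
within `4/5` of `tw (3b)` and whose deviation is within `b·sb` of `e₀` — each block's three segments are anchored at the block's initial junction atom,
so the depth grows by ONE per block. [this file, g89] -/
theorem labelChain_blocks {p₀ V : E3} (tw : ℕ → E3) (htw : ∀ j, tw j = lab p₀ + ((j : ℝ) / 21) • V) (hV : ‖V‖ ≤ 63 / 4)
    (hstep : ∀ c ∈ C, ∀ g : E3, ∃ a : ℝ, 9 / 10 ≤ a ∧ a ≤ 1 ∧ ∃ c' ∈ C, ∃ y : E3,
      dist c' y ≤ a / 16 + ϑr ∧ dist y c = a ∧ dist y (c + g) ^ 2 ≤ ‖g‖ ^ 2 - Real.sqrt 2 * a * ‖g‖ + a ^ 2)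
    (hϑr : ϑr ≤ 1 / 10000) (hlabC : ∀ p ∈ S, dist p kᵤ ≤ R₁ → lab p ∈ C)
    (hlift : ∀ p ∈ S, dist p kᵤ ≤ R₁ → ∀ c' ∈ C, IsBond (lab p) c' → ∃ p' ∈ S, dist p p' ≤ 17 / 16 ∧ lab p' = c')
    (hcoreR : ∀ p ∈ S, dist p kᵤ ≤ R₁ + 17 / 16 → p ∈ core)
    (hstar : ∀ p ∈ core, ∀ p' ∈ core, dist (lab p) (lab p') ≤ Rg → ‖(p - lab p) - (p' - lab p')‖ ≤ sb)
    (hRg : 23 / 5 ≤ Rg) (hsb : 0 ≤ sb) (hsb7 : 7 * sb ≤ 7 / 20) (hR₁ : R₀ + 19 / 10 ≤ R₁)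
    (he₀ : e₀ = p₀ - lab p₀) (hp₀ : p₀ ∈ S) (hp₀k : dist p₀ kᵤ ≤ R₁) (hballj : ∀ j : ℕ, j ≤ 21 → dist (tw j + e₀) kᵤ ≤ R₀) :
    ∀ b : ℕ, b ≤ 7 → ∃ q₁ ∈ S, dist q₁ kᵤ ≤ R₁ ∧ dist (lab q₁) (tw (3 * b)) ≤ 4 / 5 ∧ ‖(q₁ - lab q₁) - e₀‖ ≤ b * sb := by
  -- way-point spacing
  have htwd : ∀ j i : ℕ, dist (tw (j + i)) (tw j) = (i : ℝ) / 21 * ‖V‖ := by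
    intro j i
    rw [htw, htw, dist_eq_norm, Nat.cast_add, show lab p₀ + (((j : ℝ) + i) / 21) • V - (lab p₀ + ((j : ℝ) / 21) • V) = ((i : ℝ) / 21) • V by
      rw [add_div, add_smul]; abel, norm_smul, Real.norm_eq_abs, abs_of_nonneg (by positivity)]
  have htw1 : ∀ j i : ℕ, (i : ℝ) ≤ 3 → dist (tw (j + i)) (tw j) ≤ i * (3 / 4) := by
    intro j i hi
    rw [htwd]
    have : (0 : ℝ) ≤ i := Nat.cast_nonneg i
    nlinarith [norm_nonneg V]
  intro b
  induction b with
  | zero =>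
    intro _
    refine ⟨p₀, hp₀, hp₀k, ?_, ?_⟩
    · rw [Nat.mul_zero, htw, Nat.cast_zero, zero_div, zero_smul, add_zero, dist_self]; norm_num
    · rw [he₀, sub_self, norm_zero, Nat.cast_zero, zero_mul]
  | succ b ih =>
    intro hb
    obtain ⟨q₀, hq₀S, hq₀k, hq₀t, hq₀e⟩ := ih (by omega)
    have hq₀core : q₀ ∈ core := hcoreR q₀ hq₀S (by linarith)
    have hbd : ((b : ℕ) : ℝ) + 1 ≤ 7 := by
      have : ((b + 1 : ℕ) : ℝ) ≤ 7 := by exact_mod_cast hb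
      push_cast at this; linarith
    -- anchor data for the three way-points of this block
    have hanc : ∀ i : ℕ, (i : ℝ) ≤ 3 → dist (tw (3 * b + i)) (lab q₀) ≤ 61 / 20 := by
      intro i hi
      calc dist (tw (3 * b + i)) (lab q₀) ≤ dist (tw (3 * b + i)) (tw (3 * b)) + dist (tw (3 * b)) (lab q₀) := dist_triangle _ _ _
        _ ≤ i * (3 / 4) + 4 / 5 := add_le_add (htw1 (3 * b) i hi) (by rw [dist_comm]; exact hq₀t)
        _ ≤ 61 / 20 := by nlinarith
    have hseg : ∀ i : ℕ, (i : ℝ) ≤ 3 → 3 * b + i ≤ 21 → ∀ p ∈ S, dist p kᵤ ≤ R₁ → dist (lab p) (tw (3 * b + i)) ≤ 31 / 20 →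
        ‖(p - lab p) - e₀‖ ≤ (b + 1) * sb →
          ∃ p₁ ∈ S, dist p₁ kᵤ ≤ R₁ ∧ dist (lab p₁) (tw (3 * b + i)) ≤ 4 / 5 ∧ ‖(p₁ - lab p₁) - e₀‖ ≤ (b + 1) * sb := by
      intro i hi hij p hp hpk hpt hpe
      exact labelChain_segment hstep hϑr hlabC hlift hcoreR hstar hq₀core hq₀e (hanc i hi) hRg hsb hbd hsb7 (hballj _ hij) hR₁ _ p hp hpk
        hpt hpe le_rfl
    -- segment 1
    obtain ⟨q₁, hq₁S, hq₁k, hq₁t, hq₁e⟩ := hseg 1 (by norm_num) (by omega) q₀ hq₀S hq₀k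
      (by linarith [dist_triangle (lab q₀) (tw (3 * b)) (tw (3 * b + 1)), htw1 (3 * b) 1 (by norm_num), dist_comm (tw (3 * b + 1)) (tw (3 * b))])
      (by nlinarith)
    -- segment 2
    have h12 : dist (tw (3 * b + 2)) (tw (3 * b + 1)) ≤ 3 / 4 := by
      have := htw1 (3 * b + 1) 1 (by norm_num); rw [show 3 * b + 1 + 1 = 3 * b + 2 by ring] at this; linarith
    obtain ⟨q₂, hq₂S, hq₂k, hq₂t, hq₂e⟩ := hseg 2 (by norm_num) (by omega) q₁ hq₁S hq₁k
      (by linarith [dist_triangle (lab q₁) (tw (3 * b + 1)) (tw (3 * b + 2)), dist_comm (tw (3 * b + 2)) (tw (3 * b + 1))]) hq₁e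
    -- segment 3
    have h23 : dist (tw (3 * b + 3)) (tw (3 * b + 2)) ≤ 3 / 4 := by
      have := htw1 (3 * b + 2) 1 (by norm_num); rw [show 3 * b + 2 + 1 = 3 * b + 3 by ring] at this; linarith
    obtain ⟨q₃, hq₃S, hq₃k, hq₃t, hq₃e⟩ := hseg 3 (by norm_num) (by omega) q₂ hq₂S hq₂k
      (by linarith [dist_triangle (lab q₂) (tw (3 * b + 2)) (tw (3 * b + 3)), dist_comm (tw (3 * b + 3)) (tw (3 * b + 2))]) hq₂e
    refine ⟨q₃, hq₃S, hq₃k, ?_, ?_⟩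
    · rw [show 3 * (b + 1) = 3 * b + 3 by ring]; exact hq₃t
    · push_cast; exact hq₃e

end Chain

end Summit.AtomisticToContinuum.Crystallization.Theorems.ChartedZeroExcessLayeredLatticeLiouville

end
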